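/-
Copyright (c) 2026 the pub-hodgecm-mathlib formalisation cell (harness21).  Prover seat hodgecm-mathlib-K2E4-p08 (g2), Track B «K2-LIT» ∕ h413,
‹S› ROAD J brick J2♯: the index inequality `ν(K)⁻¹ + ν(K′)⁻¹ < ν(I)⁻¹` of the EP triple from COSET WITNESSES (generic Haar bookkeeping).  2026-09-03.
-/
import Mathlib.MeasureTheory.Group.Measure
import Mathlib.MeasureTheory.Measure.Haar.Basic
import HarnessLib

/-!
# Haar measure of a subgroup versus finitely many pairwise inequivalent cosets of a smaller subgroup — the index inequality of Kottwitz's EP triple from witnesses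
# (Kottwitz 1988 §2; Serre, *Trees* II.1.1: the star of a vertex has `q + 1 ≥ 3` edges, an edge has `2` ends)

Topic `MeasureTheory/Group`; namespace `Literature.MeasureTheory.Group`.  KERNEL LANE: theorems only (no `def`, no instance, no notation, no named fact, no `sorry`).
Cell `pub/hodgecm-mathlib` (D-0151), crux H413 = `stmt-HodgeConjecture-24833`, Track B «K2-LIT», ‹S› road J brick J2♯ (K2E4-p08 (g2)): ★ `RankOneEulerPoincareGlueCentralValue`
(p855520) turns Kottwitz's EP glue into «`f_EP` is a NEGATIVE constant on `K ⊓ K′ ⊓ I`» under the hypothesis `hidx : ν(K)⁻¹ + ν(K′)⁻¹ < ν(I)⁻¹`.  THIS FILE reduces `hidx` to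
pure MEMBERSHIP facts, so that the per-place discharge is matrix algebra in the one-place model: three elements of `K` pairwise inequivalent modulo `I` (`1`, the Weyl
element, a lower unipotent with an anti-fixed unit — three edges of the star) and one element of `K′` outside `I` (two ends of the edge) give `3·ν(I) ≤ ν(K)`, `2·ν(I) ≤ ν(K′)`,
hence `ν(K)⁻¹ + ν(K′)⁻¹ ≤ (1∕3 + 1∕2)·ν(I)⁻¹ < ν(I)⁻¹`.

* `card_mul_measure_le_of_pairwise_not_mem` — `ν` left-invariant, `I ≤ K` subgroups, `I` measurable, `S ⊆ K` a finite set of pairwise `I`-inequivalent elements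
  (`k₁⁻¹ k₂ ∉ I`): `#S · ν(I) ≤ ν(K)`.
* `toReal_inv_add_toReal_inv_lt_of_le` — `3·ν(I) ≤ ν(K)`, `2·ν(I) ≤ ν(K′)`, `0 < ν(I)`, `ν(K), ν(K′) < ∞` ⇒ `ν(K).toReal⁻¹ + ν(K′).toReal⁻¹ < ν(I).toReal⁻¹`.
* **`toReal_inv_add_toReal_inv_lt_of_witnesses`** — the two combined: the `hidx` of ★ `exists_isLocSmooth_classOrbitalIntegral_eq_one_zero_and_apply_neg_of_relations` from
  three `I`-inequivalent elements of `K` and one element of `K′ ∖ I`.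
HONEST LABEL: HC_CM is proved only modulo the 7 printed citations (2 remaining named inputs: hLiu418 = stmt-HodgeConjecture-24832, h413 = stmt-HodgeConjecture-24833) until rung 0
closes; this file discharges no count (generic measure bookkeeping).

## References
* [Kottwitz1988] R. E. Kottwitz, *Tamagawa numbers*, Ann. of Math. 127 (1988), §2 Theorem 2.
* [Serre1980Trees] J.-P. Serre, *Trees* (1980), II.1.1.
* [DeitmarEchterhoff2014] A. Deitmar, S. Echterhoff, *Principles of Harmonic Analysis*, 2nd ed. (2014), §1.5 (invariance of Haar measure).
-/

set_option autoImplicit false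

noncomputable section

open MeasureTheory Measure Set
open scoped ENNReal Pointwise

namespace Literature.MeasureTheory.Group

variable {G : Type*} [Group G] [MeasurableSpace G] [MeasurableMul G]

/-- **Pairwise `I`-inequivalent elements of `K` give disjoint translates of `I` inside `K`: `#S · ν(I) ≤ ν(K)`** for a left-invariant measure `ν`.
[cite: DeitmarEchterhoff2014, §1.5] [cite: Serre1980Trees, II.1.1] -/
theorem card_mul_measure_le_of_pairwise_not_mem (ν : Measure G) [ν.IsMulLeftInvariant] {I K : Subgroup G} (hIK : I ≤ K)
    (hI : MeasurableSet (I : Set G)) (S : Finset G) (hS : ∀ k ∈ S, k ∈ K)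
    (hne : ∀ k₁ ∈ S, ∀ k₂ ∈ S, k₁ ≠ k₂ → k₁⁻¹ * k₂ ∉ I) :
    (S.card : ℝ≥0∞) * ν (I : Set G) ≤ ν (K : Set G) := by
  classical
  -- the translates `k • I`, `k ∈ S`
  have hmeas : ∀ k ∈ S, MeasurableSet (k • (I : Set G)) := fun k _ => hI.const_smul k
  have hsub : (⋃ k ∈ S, k • (I : Set G)) ⊆ (K : Set G) := by
    intro x hx
    simp only [mem_iUnion] at hx
    obtain ⟨k, hk, hx⟩ := hx
    obtain ⟨i, hi, rfl⟩ := mem_smul_set.1 hx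
    exact K.mul_mem (hS k hk) (hIK hi)
  have hdisj : (S : Set G).PairwiseDisjoint fun k => k • (I : Set G) := by
    intro k₁ hk₁ k₂ hk₂ hk
    rw [Function.onFun, Set.disjoint_left]
    intro x hx₁ hx₂
    obtain ⟨i₁, hi₁, rfl⟩ := mem_smul_set.1 hx₁
    obtain ⟨i₂, hi₂, h⟩ := mem_smul_set.1 hx₂
    apply hne k₁ hk₁ k₂ hk₂ hk
    -- `k₂ i₂ = k₁ i₁` ⇒ `k₁⁻¹ k₂ = i₁ i₂⁻¹ ∈ I`
    have : k₁⁻¹ * k₂ = i₁ * i₂⁻¹ := by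
      have h' : k₂ * i₂ = k₁ * i₁ := h
      rw [eq_mul_inv_iff_mul_eq, mul_assoc, inv_mul_eq_iff_eq_mul]
      exact h'
    rw [this]
    exact I.mul_mem hi₁ (I.inv_mem hi₂)
  calc (S.card : ℝ≥0∞) * ν (I : Set G)
      = ∑ k ∈ S, ν (k • (I : Set G)) := by
        rw [Finset.sum_congr rfl fun k _ => measure_smul ν k (I : Set G), Finset.sum_const, nsmul_eq_mul]
    _ = ν (⋃ k ∈ S, k • (I : Set G)) := (measure_biUnion_finset hdisj hmeas).symm
    _ ≤ ν (K : Set G) := measure_mono hsub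

/-- **Arithmetic**: `3a ≤ x`, `2a ≤ y`, `0 < a`, `x, y < ∞` ⇒ `x⁻¹ + y⁻¹ < a⁻¹` (real parts). [cite: Kottwitz1988, §2] -/
theorem toReal_inv_add_toReal_inv_lt_of_le {a x y : ℝ≥0∞} (h3 : 3 * a ≤ x) (h2 : 2 * a ≤ y) (ha : 0 < a) (hx : x < ⊤) (hy : y < ⊤) :
    x.toReal⁻¹ + y.toReal⁻¹ < a.toReal⁻¹ := by
  have ha' : a < ⊤ := lt_of_le_of_lt (le_trans (by
    calc a = 1 * a := (one_mul a).symm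
      _ ≤ 3 * a := by gcongr; norm_num) h3) hx
  have har : 0 < a.toReal := ENNReal.toReal_pos ha.ne' ha'.ne
  have h3r : 3 * a.toReal ≤ x.toReal := by
    have := ENNReal.toReal_mono hx.ne h3
    rwa [ENNReal.toReal_mul, show (3 : ℝ≥0∞).toReal = 3 by norm_num] at this
  have h2r : 2 * a.toReal ≤ y.toReal := by
    have := ENNReal.toReal_mono hy.ne h2
    rwa [ENNReal.toReal_mul, show (2 : ℝ≥0∞).toReal = 2 by norm_num] at this
  have hxr : 0 < x.toReal := lt_of_lt_of_le (by positivity) h3r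
  have hyr : 0 < y.toReal := lt_of_lt_of_le (by positivity) h2r
  calc x.toReal⁻¹ + y.toReal⁻¹ ≤ (3 * a.toReal)⁻¹ + (2 * a.toReal)⁻¹ := by
        gcongr
    _ = (5 / 6) * a.toReal⁻¹ := by field_simp; ring
    _ < a.toReal⁻¹ := by
        have : 0 < a.toReal⁻¹ := inv_pos.2 har
        nlinarith

/-- **The EP triple's index inequality from witnesses**: `ν` left-invariant; `I ≤ K`, `I ≤ K′`; `I` measurable, `ν(I) > 0`, `ν(K), ν(K′) < ∞`; three elements
`k₁, k₂, k₃ ∈ K` pairwise `I`-inequivalent and one `x ∈ K′ ∖ I` ⇒ `ν(K)⁻¹ + ν(K′)⁻¹ < ν(I)⁻¹` — the hypothesis `hidx` of ★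
`exists_isLocSmooth_classOrbitalIntegral_eq_one_zero_and_apply_neg_of_relations`. [cite: Kottwitz1988, §2 Theorem 2] [cite: Serre1980Trees, II.1.1] -/
theorem toReal_inv_add_toReal_inv_lt_of_witnesses (ν : Measure G) [ν.IsMulLeftInvariant] {I K K' : Subgroup G} (hIK : I ≤ K) (hIK' : I ≤ K')
    (hI : MeasurableSet (I : Set G)) (hI0 : 0 < ν (I : Set G)) (hK : ν (K : Set G) < ⊤) (hK' : ν (K' : Set G) < ⊤)
    {k₁ k₂ k₃ : G} (hk₁ : k₁ ∈ K) (hk₂ : k₂ ∈ K) (hk₃ : k₃ ∈ K)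
    (h₁₂ : k₁⁻¹ * k₂ ∉ I) (h₁₃ : k₁⁻¹ * k₃ ∉ I) (h₂₃ : k₂⁻¹ * k₃ ∉ I)
    {x : G} (hx : x ∈ K') (hxI : x ∉ I) :
    (ν (K : Set G)).toReal⁻¹ + (ν (K' : Set G)).toReal⁻¹ < (ν (I : Set G)).toReal⁻¹ := by
  classical
  -- inequivalence is symmetric modulo the subgroup `I`
  have hsymm : ∀ {a b : G}, a⁻¹ * b ∉ I → b⁻¹ * a ∉ I := fun {a b} h hba =>
    h (by have := I.inv_mem hba; rwa [mul_inv_rev, inv_inv] at this)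
  -- three cosets in `K`
  have h3 : 3 * ν (I : Set G) ≤ ν (K : Set G) := by
    have hne12 : k₁ ≠ k₂ := fun h => h₁₂ (by rw [h, inv_mul_cancel]; exact I.one_mem)
    have hne13 : k₁ ≠ k₃ := fun h => h₁₃ (by rw [h, inv_mul_cancel]; exact I.one_mem)
    have hne23 : k₂ ≠ k₃ := fun h => h₂₃ (by rw [h, inv_mul_cancel]; exact I.one_mem)
    have hcard : ({k₁, k₂, k₃} : Finset G).card = 3 := by
      rw [Finset.card_insert_of_notMem (by simp [hne12, hne13]), Finset.card_insert_of_notMem (by simp [hne23]), Finset.card_singleton]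
    have h := card_mul_measure_le_of_pairwise_not_mem ν hIK hI {k₁, k₂, k₃}
      (fun k hk => by
        simp only [Finset.mem_insert, Finset.mem_singleton] at hk
        rcases hk with rfl | rfl | rfl <;> assumption)
      (fun a ha b hb hab => by
        simp only [Finset.mem_insert, Finset.mem_singleton] at ha hb
        rcases ha with rfl | rfl | rfl <;> rcases hb with rfl | rfl | rfl <;>
          first | exact (hab rfl).elim | exact h₁₂ | exact h₁₃ | exact h₂₃ | exact hsymm h₁₂ | exact hsymm h₁₃ | exact hsymm h₂₃)
    rw [hcard] at h
    exact_mod_cast h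
  -- two cosets in `K′`
  have h2 : 2 * ν (I : Set G) ≤ ν (K' : Set G) := by
    have hne : (1 : G) ≠ x := fun h => hxI (h ▸ I.one_mem)
    have hcard : ({1, x} : Finset G).card = 2 := by
      rw [Finset.card_insert_of_notMem (by simp [hne]), Finset.card_singleton]
    have h1x : (1 : G)⁻¹ * x ∉ I := by rwa [inv_one, one_mul]
    have h := card_mul_measure_le_of_pairwise_not_mem ν hIK' hI {1, x}
      (fun k hk => by
        simp only [Finset.mem_insert, Finset.mem_singleton] at hk
        rcases hk with rfl | rfl
        · exact K'.one_mem
        · exact hx)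
      (fun a ha b hb hab => by
        simp only [Finset.mem_insert, Finset.mem_singleton] at ha hb
        rcases ha with rfl | rfl <;> rcases hb with rfl | rfl <;>
          first | exact (hab rfl).elim | exact h1x | exact hsymm h1x)
    rw [hcard] at h
    exact_mod_cast h
  exact toReal_inv_add_toReal_inv_lt_of_le h3 h2 hI0 hK hK'

end Literature.MeasureTheory.Group

end
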